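import Mathlib
import Summits.ValiantsHypothesis.ValiantsHypothesis.Theorems.DivisionGapZeroOneTransferSqPartner
import Summits.ValiantsHypothesis.ValiantsHypothesis.Theorems.DivisionGapZeroOneTransferFaceEnginePow

/-!
# Crux `DivisionGap.ZeroOneTransfer` (stmt-ValiantsHypothesis-5066), line `charged-uncharged`, Part E-III
(lead c13): NO MIXED PRODUCT `D_n^{M+1} · Sq_n^{M'}` IS AN MM CERTIFICATE — uniformly in `M, M'`

Rung E-I (`Theorems/DivisionGapZeroOneTransferSqPartner.lean`) kills the square-grid partner `X = Sq_n`;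
lead c12's Part D-II kills the powers `X = D_n^M`.  With the face engine for POWERS (`stub_faceEnginePow`,
`Theorems/DivisionGapZeroOneTransferFaceEnginePow.lean`: block substitution is a ring homomorphism, then
`triPM_pow_lower_bound`) the same free top form along the frozen brick zone handles every mixed product:

* `sq_pow_partner_lower_bound` — `∃ κ, ∀ n m M M'` (even `n`, `4 ∣ m`, `68 ≤ m`, `3m + 4 ≤ n`,
  `24L + 60 ≤ m - 4`): `T^L ≤ (((n²+2)(L₊(D_n^{M+1} · Sq_n^{M'}) + 3))^κ + 1) · (T-1)^L` — the top form is
  `D_n[E0sq]^{M+1} · x^{M'·u₀}` (top forms are multiplicative, `SqPowPartner.topComponent_pow`).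
* `not_qp_complexity_triPM_pow_mul_sqPM_pow` — no `c` admits, for every `n`, exponents `M, M'` with
  `L₊(D_n^{M+1} · Sq_n^{M'}) ≤ 2^((log₂ n + c)^c)`; in particular `det(Kasteleyn) · Sq_n^{M'} = D_n² · Sq_n^{M'}`
  and `D_n · (D_n Sq_n)^{M}` are not certificates.
[cite: Valiant1980, §3 Thm 1] [cite: JuknaSeiwertSergeev2022, Lemma 2]
-/

-- `Summit.ValiantsHypothesis.ValiantsHypothesis.…` is the tree's mandated single-conjunct layout
-- (Sub = Summit), so the duplicated namespace component is intended.

noncomputable section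

set_option linter.dupNamespace false

namespace Summit.ValiantsHypothesis.ValiantsHypothesis.Theorems.DivisionGapZeroOneTransfer

open MvPolynomial
open Literature.Computability.AlgebraicComplexity
open Summit.ValiantsHypothesis.ValiantsHypothesis.Theorems.TriangularDimersDivisionEasy.Negative
open Summit.ValiantsHypothesis.ValiantsHypothesis.Theorems.ZeroOneTransfer
open FaceIsolation
open scoped NNReal BigOperators

namespace SqPowPartner

variable {n : ℕ}

/-- Top components of powers over `ℝ≥0`. [folklore] -/
theorem topComponent_pow {σ : Type*} (w : σ → ℕ) (p : MvPolynomial σ ℝ≥0) (k : ℕ) :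
    Negative.topComponent w (p ^ k) = Negative.topComponent w p ^ k := by
  induction k with
  | zero => simp
  | succ k ih => rw [pow_succ, Negative.topComponent_mul, ih, pow_succ]

end SqPowPartner

open SqPowPartner SqPartner

/-- **Rung E-III: NO MIXED PRODUCT `D_n^{M+1} · Sq_n^{M'}` IS MONOTONE-CHEAP.**  For even `n`,
`m ≡ 0 (mod 4)`, `68 ≤ m`, `3m + 4 ≤ n`, `24L + 60 ≤ m - 4`, and ALL `M, M'`:
`T^L ≤ (((n²+2)(L₊(D_n^{M+1} · Sq_n^{M'}) + 3))^κ + 1) · (T-1)^L`.  The top form along the indicator weight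
of `E0sq m (m+2)` is `D_n[E0sq]^{M+1} · x^{M'·u₀}` (top forms are multiplicative; the brick zones are
frozen), then the engine for powers on the block of the first zone.  (`M' = 0`: lead c12's D-II with the JSS
loss; `M' = 1, M = 0`: rung E-I.) [cite: Valiant1980, §3 Thm 1] [cite: JuknaSeiwertSergeev2022, Lemma 2] -/
theorem sq_pow_partner_lower_bound : ∃ κ : ℕ, ∀ (n m M M' : ℕ), Even n → m % 4 = 0 → 68 ≤ m →
    3 * m + 4 ≤ n → ∀ L : ℕ, 24 * L + 60 ≤ m - 4 →
      Tfib ^ L ≤ (((n * n + 2) * (complexity (triPM n ^ (M + 1) * sqPM n ^ M') + 3)) ^ κ + 1) *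
        (Tfib - 1) ^ L := by
  obtain ⟨κ, hκ⟩ := stub_faceEnginePow
  refine ⟨κ, fun n m M M' hn hm4 h68 hnm L hL => ?_⟩
  have hme : Even m := Nat.even_iff.2 (by omega)
  have hbe : Even (m + 2) := Nat.even_iff.2 (by omega)
  have hnb : (m + 2) + 2 * m + 2 ≤ n := by omega
  obtain ⟨hu0, hval⟩ := stub_u0_isSqDimer n m (m + 2) hn hme hbe (by omega) le_rfl hnb
  have hbrick := u0_eq_brick_of_agree (n := n) hval
  have huniq := stub_brickZone_unique n m (m + 2) hme hbe le_rfl hnb hbrick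
  obtain ⟨hblk, g, hg⟩ := stub_ringCover n m (m + 2) hn hm4 hbe (by omega) le_rfl hnb hu0 hval
  have hu0mem : u0 m (m + 2) ∈ sqDimers n := (mem_sqDimers_iff _).2 hu0
  have hinside : ∀ v : Vtx n, E0sq m (m + 2) v (u0 m (m + 2) v) := fun v => Or.inr rfl
  have htopD : Negative.topComponent (wInd (E0sq m (m + 2))) (triPM n) = triPMIn (E0sq m (m + 2)) :=
    stub_topComponent_wInd_triPM n (E0sq m (m + 2))
      ⟨u0 m (m + 2), sqDimers_subset_dimers hu0mem, hinside⟩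
  have htopS : Negative.topComponent (wInd (E0sq m (m + 2))) (sqPM n) = sqPMIn (E0sq m (m + 2)) :=
    stub_topComponent_wInd_sqPM n (E0sq m (m + 2)) ⟨u0 m (m + 2), hu0mem, hinside⟩
  have hmono : sqPMIn (E0sq m (m + 2)) = monomial (dimerExp (u0 (n := n) m (m + 2))) 1 := by
    refine stub_sqPMIn_eq_monomial n (E0sq m (m + 2)) (u0 m (m + 2)) hu0mem hinside
      fun f hf hfin => ?_
    refine huniq f ((mem_sqDimers_iff f).1 hf) fun v => ?_
    rcases hfin v with ⟨k, hk1, hk2, -⟩ | h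
    · exact Or.inl ⟨k, hk1, hk2, (((mem_sqDimers_iff f).1 hf) v).2.2⟩
    · exact Or.inr h
  have htop : Negative.topComponent (wInd (E0sq m (m + 2))) (triPM n ^ (M + 1) * sqPM n ^ M') =
      triPMIn (E0sq m (m + 2)) ^ (M + 1) * monomial (M' • dimerExp (u0 (n := n) m (m + 2))) 1 := by
    rw [Negative.topComponent_mul, topComponent_pow, topComponent_pow, htopD, htopS, hmono,
      monomial_pow, one_pow]
  have hcx : complexity (triPMIn (E0sq m (m + 2)) ^ (M + 1) *
      monomial (M' • dimerExp (u0 (n := n) m (m + 2))) 1) ≤ complexity (triPM n ^ (M + 1) * sqPM n ^ M') := by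
    rw [← htop]; exact Negative.complexity_topComponent_le _ _
  have hme4 : Even (m - 4) := Nat.even_iff.2 (by omega)
  have key := hκ n (E0sq m (m + 2)) (M' • dimerExp (u0 (n := n) m (m + 2))) 1 one_ne_zero 2 (m + 2 + 2)
    (m - 4) M (by omega) hme4 (by omega) (by omega) hblk ⟨g, hg⟩ L hL
  calc Tfib ^ L ≤ (((n * n + 2) * (complexity (triPMIn (E0sq m (m + 2)) ^ (M + 1) *
        monomial (M' • dimerExp (u0 (n := n) m (m + 2))) 1) + 3)) ^ κ + 1) * (Tfib - 1) ^ L := key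
    _ ≤ (((n * n + 2) * (complexity (triPM n ^ (M + 1) * sqPM n ^ M') + 3)) ^ κ + 1) * (Tfib - 1) ^ L := by
      gcongr

namespace SqPowPartner

/-- Exponent bookkeeping: `κ (2j + 7 + (j+2+c)^c) + 3 ≤ (j + (c+10+2κ))^(c+10+2κ)`. [folklore] -/
theorem kappa_bound' (κ j c : ℕ) :
    κ * (2 * j + 7 + (j + 2 + c) ^ c) + 3 ≤ (j + (c + 10 + 2 * κ)) ^ (c + 10 + 2 * κ) := by
  set B := j + (c + 10 + 2 * κ) with hB
  have hB9 : 10 ≤ B := by omega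
  have h1 : 2 * j + 7 ≤ B ^ 2 := by nlinarith
  have h2 : (j + 2 + c) ^ c ≤ B ^ c := Nat.pow_le_pow_left (by omega) c
  have h3 : B ^ 2 ≤ B ^ (c + 2) := Nat.pow_le_pow_right (by omega) (by omega)
  have h4 : B ^ c ≤ B ^ (c + 2) := Nat.pow_le_pow_right (by omega) (by omega)
  have h5 : 2 * j + 7 + (j + 2 + c) ^ c ≤ 2 * B ^ (c + 2) := by omega
  have h6 : 2 * κ ≤ B := by omega
  have h7 : 3 ≤ B ^ (c + 3) := le_trans (by omega : 3 ≤ B) (Nat.le_self_pow (by omega) B)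
  calc κ * (2 * j + 7 + (j + 2 + c) ^ c) + 3 ≤ κ * (2 * B ^ (c + 2)) + 3 := by
        have := Nat.mul_le_mul_left κ h5; omega
    _ = (2 * κ) * B ^ (c + 2) + 3 := by ring
    _ ≤ B * B ^ (c + 2) + B ^ (c + 3) := add_le_add (Nat.mul_le_mul_right _ h6) h7
    _ = 2 * B ^ (c + 3) := by ring
    _ ≤ B * B ^ (c + 3) := Nat.mul_le_mul_right _ (by omega)
    _ = B ^ (c + 4) := by ring
    _ ≤ B ^ (c + 10 + 2 * κ) := Nat.pow_le_pow_right (by omega) (by omega)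

/-- From `L₊(D_n^{M+1} · Sq_n^{M'}) ≤ 2^((log₂ n + c)^c)` at `n = 2^(j+2)`: the engine's quantity, weakened
to the shape of `key_ineq_of_bound`, is at most `2^((j + c')^c')`, `c' = c + 10 + 2κ`. [folklore] -/
theorem engine_quantity_le' {κ c j M M' : ℕ}
    (h : complexity (triPM (2 ^ (j + 2)) ^ (M + 1) * sqPM (2 ^ (j + 2)) ^ M') ≤ bound c (2 ^ (j + 2))) :
    ((2 ^ (j + 2) * 2 ^ (j + 2) + 2) *
        (complexity (triPM (2 ^ (j + 2)) ^ (M + 1) * sqPM (2 ^ (j + 2)) ^ M') + 3)) ^ κ + 1 ≤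
      2 ^ ((j + (c + 10 + 2 * κ)) ^ (c + 10 + 2 * κ)) := by
  have hlog : Nat.log 2 (2 ^ (j + 2)) = j + 2 := Nat.log_pow (by norm_num) _
  unfold bound at h
  rw [hlog] at h
  set Cx := complexity (triPM (2 ^ (j + 2)) ^ (M + 1) * sqPM (2 ^ (j + 2)) ^ M') with hCx
  have h1 : 2 ^ (j + 2) * 2 ^ (j + 2) + 2 ≤ 2 ^ (2 * j + 5) := by
    have e : 2 ^ (j + 2) * 2 ^ (j + 2) = 2 ^ (2 * j + 4) := by rw [← pow_add]; ring_nf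
    have e2 : 2 ^ (2 * j + 5) = 2 ^ (2 * j + 4) * 2 := by rw [← pow_succ]
    have : 2 ≤ 2 ^ (2 * j + 4) := by
      calc 2 = 2 ^ 1 := by norm_num
        _ ≤ 2 ^ (2 * j + 4) := Nat.pow_le_pow_right (by norm_num) (by omega)
    rw [e, e2]
    omega
  have h2 : Cx + 3 ≤ 2 ^ ((j + 2 + c) ^ c + 2) := by
    have e3 : 2 ^ ((j + 2 + c) ^ c + 2) = 2 ^ ((j + 2 + c) ^ c) * 4 := by rw [pow_add]; norm_num
    have : 1 ≤ 2 ^ ((j + 2 + c) ^ c) := Nat.one_le_two_pow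
    rw [e3]
    omega
  have hpow : ((2 ^ (j + 2) * 2 ^ (j + 2) + 2) * (Cx + 3)) ^ κ ≤ 2 ^ (κ * (2 * j + 7 + (j + 2 + c) ^ c)) :=
    calc ((2 ^ (j + 2) * 2 ^ (j + 2) + 2) * (Cx + 3)) ^ κ
        ≤ (2 ^ (2 * j + 5) * 2 ^ ((j + 2 + c) ^ c + 2)) ^ κ := Nat.pow_le_pow_left (Nat.mul_le_mul h1 h2) κ
      _ = 2 ^ (κ * (2 * j + 7 + (j + 2 + c) ^ c)) := by rw [← pow_add, ← pow_mul]; congr 1; ring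
  have hone : (1 : ℕ) ≤ 2 ^ (κ * (2 * j + 7 + (j + 2 + c) ^ c)) := Nat.one_le_two_pow
  calc ((2 ^ (j + 2) * 2 ^ (j + 2) + 2) * (Cx + 3)) ^ κ + 1
      ≤ 2 ^ (κ * (2 * j + 7 + (j + 2 + c) ^ c)) + 2 ^ (κ * (2 * j + 7 + (j + 2 + c) ^ c)) :=
        add_le_add hpow hone
    _ = 2 ^ (κ * (2 * j + 7 + (j + 2 + c) ^ c) + 1) := by rw [pow_succ]; ring
    _ ≤ 2 ^ ((j + (c + 10 + 2 * κ)) ^ (c + 10 + 2 * κ)) :=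
        Nat.pow_le_pow_right (by norm_num) (by have := kappa_bound' κ j c; omega)

end SqPowPartner

/-- **No mixed product `D_n^{M+1} · Sq_n^{M'}` is quasi-polynomial, uniformly in `M, M'`** (asymptotic form
of rung E-III): no constant `c` admits, for every `n`, exponents `M, M'` with
`L₊(D_n^{M+1} · Sq_n^{M'}) ≤ 2^((log₂ n + c)^c)`. [cite: Valiant1980, §3 Thm 1]
[cite: JuknaSeiwertSergeev2022, Lemma 2] -/
theorem not_qp_complexity_triPM_pow_mul_sqPM_pow :
    ¬ ∃ c : ℕ, ∀ n : ℕ, ∃ M M' : ℕ, complexity (triPM n ^ (M + 1) * sqPM n ^ M') ≤ bound c n := by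
  rintro ⟨c, H⟩
  obtain ⟨κ, hκ⟩ := sq_pow_partner_lower_bound
  obtain ⟨j, hj6, hviol⟩ := exists_m_violating (c + 10 + 2 * κ)
  obtain ⟨M, M', hle⟩ := H (2 ^ (j + 2))
  have h64 : 64 ≤ 2 ^ j := by
    calc 64 = 2 ^ 6 := by norm_num
      _ ≤ 2 ^ j := Nat.pow_le_pow_right (by norm_num) hj6
  have h4 : 2 ^ j % 4 = 0 := by
    have : 2 ^ j = 2 ^ (j - 2) * 4 := by
      rw [show (4 : ℕ) = 2 ^ 2 by norm_num, ← pow_add]; congr 1; omega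
    rw [this]; exact Nat.mul_mod_left _ _
  have hn : Even (2 ^ (j + 2)) := Nat.even_pow.2 ⟨even_two, by omega⟩
  have hpow : 2 ^ (j + 2) = 4 * 2 ^ j := by rw [pow_add]; ring
  have hlb : ∀ L, 24 * L + 60 ≤ 2 ^ j →
      Tfib ^ L ≤ 4 * (((2 ^ (j + 2) * 2 ^ (j + 2) + 2) *
        (complexity (triPM (2 ^ (j + 2)) ^ (M + 1) * sqPM (2 ^ (j + 2)) ^ M') + 3)) ^ κ + 1) *
        (2 ^ j * 2 ^ j + 1) ^ 2 * (Tfib - 1) ^ L := by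
    intro L hL
    have key := hκ (2 ^ (j + 2)) (2 ^ j + 4) M M' hn (by omega) (by omega) (by omega) L (by omega)
    refine key.trans ?_
    have h1 : (1 : ℕ) ≤ 4 * (2 ^ j * 2 ^ j + 1) ^ 2 := by
      have : 1 ≤ (2 ^ j * 2 ^ j + 1) ^ 2 := Nat.one_le_pow _ _ (by omega)
      omega
    calc (((2 ^ (j + 2) * 2 ^ (j + 2) + 2) *
          (complexity (triPM (2 ^ (j + 2)) ^ (M + 1) * sqPM (2 ^ (j + 2)) ^ M') + 3)) ^ κ + 1) * (Tfib - 1) ^ L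
        = 1 * ((((2 ^ (j + 2) * 2 ^ (j + 2) + 2) *
          (complexity (triPM (2 ^ (j + 2)) ^ (M + 1) * sqPM (2 ^ (j + 2)) ^ M') + 3)) ^ κ + 1) *
          (Tfib - 1) ^ L) := by ring
      _ ≤ (4 * (2 ^ j * 2 ^ j + 1) ^ 2) * ((((2 ^ (j + 2) * 2 ^ (j + 2) + 2) *
          (complexity (triPM (2 ^ (j + 2)) ^ (M + 1) * sqPM (2 ^ (j + 2)) ^ M') + 3)) ^ κ + 1) *
          (Tfib - 1) ^ L) := Nat.mul_le_mul_right _ h1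
      _ = _ := by ring
  have hF := SqPowPartner.engine_quantity_le' (κ := κ) hle
  have hkey := key_ineq_of_bound hj6 hlb hF
  exact absurd (hkey.trans_lt hviol) (lt_irrefl _)

end Summit.ValiantsHypothesis.ValiantsHypothesis.Theorems.DivisionGapZeroOneTransfer

end
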